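/-
PORT (cell pub-hodgecm2, COR-CM = stage 2 of the Hodge ladder): tree copy of A FRAGMENT of the pub-hodgecm package module
`HodgeCM/Model/Universe.lean` (package root `run/shared/lean/pub/pub-hodgecm/lean/HodgeCMPerL/`; file md5
d9c7e6a8625f08efda5dbd895b580144): its ll. 61–143 (`cmEmb` … `universeOf` + the `Junction` rfl lemmas) and ll. 225–236
(`picardCMUniverse`), VERBATIM up to (R2) imports -> tree modules, (R3) `namespace HodgeCM` -> `Summit.HodgeConjecture.CorCM`,
(R5) `import HarnessLib`; plus ONE added junction lemma `universeOf_hc_cm_iff_codesHC` (`Iff.rfl`).  NOT ported here: the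
`ModelAxiomsPerL` / `Fact_…` theorems of that file (binder files of the model seats) and the three `IsAnisotropic` lemmas
`isAnisotropic_pmsCode_iff`, `isAnisotropic_of_two_lt`, `ballDatumOf` (they import the package's automorphic side,
`HodgeCM.Automorphic.AdelicUnitaryModel`, which is off the COR-CM path).  Seat planner-pub-hodgecm2-lead-0, 2026-08-20.
ADDENDUM AT FILING (p1): one-line docstrings on the 12 junction `rfl` lemmas (tree lint `lint.docstring`); nothing else changed.
-/
import Summits.HodgeConjecture.CorCM.Geometry.Statements
import Literature.NumberTheory.Automorphic.PicardCMUniverse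
import Literature.AlgebraicGeometry.HodgeTheory.BettiUniverseAxioms
import Literature.AlgebraicGeometry.HodgeTheory.BettiUniverseCMAction
import Literature.AlgebraicGeometry.Milne1999.CMHodgeHypothesisFromRealisations
import HarnessLib

/-!
# COR-CM — the Picard–CM model universe `Model.universeOf` / `Model.picardCMUniverse` (port of `HodgeCM.Model`)

The `Universe` (24 fields, `CorCM/Geometry/Universe.lean`) on which stage 1's E term of record
`HodgeCM.Model.perL_picardCM_r21AEOGI` (`HodgeCM/Model/E2InstanceOGR21AEPI.lean`, md5 95e6432065d923ce87004dd4e28aa807, l.34)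
concludes `U.PerL`, built over the tree records `PicardCM.BallQuotientUniformisedDatum` / `PicardCM.CMAbelianVarietyRealised`
exactly as in the package.  Junction (definitional): `(universeOf hHD hI hU h₃).HC_CM ↔ Milne1999.CodesHC hHD hU h₃`.
-/

noncomputable section

open scoped TensorProduct Matrix ComplexOrder
open NumberField
open Literature.AlgebraicGeometry.Motives (CMType)
open Literature.AlgebraicGeometry.Motives
open Literature.AlgebraicGeometry.Motives.HodgeStructure (EndAction conj ofRat)
open Literature.AlgebraicGeometry.ShimuraVarieties

namespace Summit.HodgeConjecture.CorCM

/-! ## The model universe (verbatim port of `HodgeCM.Model`, package `HodgeCM/Model/Universe.lean` ll. 61–143, 225–236;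
the `ModelAxiomsPerL` / `Fact_…` theorems of that file are NOT ported here — they belong to the binder files; three
`IsAnisotropic` lemmas omitted, see below) -/

namespace Model

open Literature.NumberTheory.Automorphic.PicardCM
open Literature.AlgebraicGeometry.HodgeTheory

/- The GU rows of MODEL-N (J-P0-G ruling B, BINDER-TRIAGE §14; G3-light, mc-axioms-1):
`hHD` = the Hodge decomposition with its real structure (R-HD), `hI` = model-independence of
`H^{p,q}` (carries R-FUN), and — on `hodgeRiemann20` only — `hHR : BettiUniverse.HodgeRiemann20`
(R-HR20). All three are KERNEL theorems of the hub tree (`…_holds`), not vendored for size. -/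
variable (hHD : exists_isReal_hodgeModel) (hI : hodgePQ_independent_of_hodgeModel)
variable (hU : Literature.NumberTheory.Automorphic.PicardCM.BallQuotientUniformisedDatum)
  (h₃ : Literature.NumberTheory.Automorphic.PicardCM.CMAbelianVarietyRealised)

/-- A fixed complex embedding of the CM field `K` (KERNEL: `K →+* ℂ` is nonempty for a number
field, `NumberField.Embeddings.instNonemptyRingHom`), selected once and for all by the global choice
function. A2 NOTE (mc-ref1-g2 entry 68): this is DATA BY CHOICE over a kernel existential, not a
cited record — nothing about the selected embedding is ever used except that it is one; any other
selection `ι'` gives the code `CMCode.ofCMType ι' Φ` with `ι'.rangeRestrictFieldEquiv.trans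
(cmCodeEquiv K Φ).symm`-isomorphic field and the transported CM type, hence an isomorphic indexed
family `U.cmAV`; the END STATE `U.PerL` is asserted for THE universe built from THIS selection
(as it is for the selection `cmRealisation h₃` of a realising abelian variety). 0 rows. -/
def cmEmb (K : CMField) : K →+* ℂ := Classical.arbitrary (K →+* ℂ)

/-- The CM code of `(K, Φ)` at the fixed embedding. -/
def cmCode (K : CMField) (Φ : CMType K) : CMCode := CMCode.ofCMType (cmEmb K) Φ

/-- `K ≃+* (cmCode K Φ).E = (cmEmb K)(K) ⊂ ℂ`. -/
def cmCodeEquiv (K : CMField) (Φ : CMType K) : K ≃+* (cmCode K Φ).E :=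
  (cmEmb K).rangeRestrictFieldEquiv

/-- The Picard code of `(L, ι₁, V, Γ)`: the hypothesis types of `PicardCode.ofHermitian` are the PKG
field types (the package's `conjRingHomK L` = the tree's `cmConjRingHom L` unfolds to `(IsCMField.complexConj L).toRingEquiv.toRingHom`). -/
def pmsCode (L : CMField) (ι₁ : L →+* ℂ) (V : HermSpace3 L ι₁) (Γ : Level V) : PicardCode :=
  PicardCode.ofHermitian ι₁ V.Hm Γ.Γ V.isHermitian V.signature_ι₁ V.posDef_of_ne Γ.isCongruence
    Γ.torsionFree

/- OMITTED from the port (they use `HodgeCM.IsAnisotropic` of the PerL-side package module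
`HodgeCM/Automorphic/AdelicUnitaryModel.lean`, not needed by COR-CM): `isAnisotropic_pmsCode_iff`,
`isAnisotropic_of_two_lt` (ll. 98–115) and `ballDatumOf` (ll. 198–203). -/

/-- The CM action on `H¹` of the CHOSEN realisation of a CM code, transported to an abstract field
`K ≃+* c.E` (G0-c `BettiUniverse.cmEndAction`; the hypothesis `IsInducedOnIntegers` is the record's
`exists_map`, reindexed by `CMRealisation.exists_map_comp`). -/
def cmActOf (c : CMCode) (K : Type) [Field K] [NumberField K] (e : K ≃+* c.E) :
    EndAction (BettiUniverse.hodge hHD (Var.isSmoothProjective hU h₃ (.cm c)) 1) K :=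
  BettiUniverse.cmEndAction ((cmRealisation h₃ c).θ.comp e.toRingHom)
    ((cmRealisation h₃ c).exists_map_comp e) hHD hI (Var.isSmoothProjective hU h₃ (.cm c))

/-- **The model universe over the packaged hypothesis (ii)** `BallQuotientUniformisedDatum` and the record
(iii): every field instantiated by the tree's constructions. -/
def universeOf : Universe where
  Var := Var
  dim := Var.dim
  Coh := Var.Coh hU h₃
  instFinite := Var.finite hU h₃
  hodge X k := BettiUniverse.hodge hHD (Var.isSmoothProjective hU h₃ X) k
  alg := Var.alg hU h₃
  Mor := Var.Mor hU h₃
  idMor := Var.idMor hU h₃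
  comp f g := Var.comp hU h₃ f g
  pull f k := BettiUniverse.pull f k
  cup X i j := BettiUniverse.cup (Var.scheme hU h₃ X) i j
  tr X k := BettiUniverse.tr (Var.isSmoothProjective hU h₃ X) k
  prod := Var.prod
  fst := Var.fst hU h₃
  snd := Var.snd hU h₃
  IsAbelianVariety := Var.IsAbelianVariety h₃
  IsCMAbelianVariety := Var.IsCMAbelianVariety h₃
  cmAV K Φ := .cm (cmCode K Φ)
  cmAct K Φ := cmActOf hHD hI hU h₃ (cmCode K Φ) K (cmCodeEquiv K Φ)
  pms L ι₁ V Γ := .pms (pmsCode L ι₁ V Γ)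

section Junction

variable {hHD hI hU h₃}

/-- Junction (`rfl`): the varieties of the model universe are the Picard–CM codes `PicardCM.Var`. -/
@[simp] theorem universeOf_Var : (universeOf hHD hI hU h₃).Var = Var := rfl
/-- Junction (`rfl`): the dimension of a code is `PicardCM.Var.dim`. -/
@[simp] theorem universeOf_dim (X : Var) : (universeOf hHD hI hU h₃).dim X = X.dim := rfl
/-- Junction (`rfl`): `H^k` of a code is the rational Betti cohomology `bettiCohomology` of its realising scheme. -/
theorem universeOf_Coh (X : Var) (k : ℕ) :
    (universeOf hHD hI hU h₃).Coh X k = bettiCohomology (Var.scheme hU h₃ X) k := rfl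
/-- Junction (`rfl`): the Hodge structure on `H^k` of a code is the tree's `BettiUniverse.hodge` of its (smooth projective) realisation. -/
theorem universeOf_hodge (X : Var) (k : ℕ) :
    (universeOf hHD hI hU h₃).hodge X k = BettiUniverse.hodge hHD (Var.isSmoothProjective hU h₃ X) k := rfl
/-- Junction (`rfl`): the algebraic classes of a code are `PicardCM.Var.alg` (rational classes of algebraic cycles on the realisation). -/
theorem universeOf_alg (X : Var) (p : ℕ) :
    (universeOf hHD hI hU h₃).alg X p = Var.alg hU h₃ X p := rfl
/-- Junction (`rfl`): morphisms between codes are scheme morphisms between their realisations. -/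
theorem universeOf_Mor (X Y : Var) :
    (universeOf hHD hI hU h₃).Mor X Y = (Var.scheme hU h₃ X ⟶ Var.scheme hU h₃ Y) := rfl
/-- Junction (`rfl`): pull-back on `H^k` is the tree's `BettiUniverse.pull`. -/
theorem universeOf_pull {X Y : Var} (f : (universeOf hHD hI hU h₃).Mor X Y) (k : ℕ) :
    (universeOf hHD hI hU h₃).pull f k = BettiUniverse.pull f k := rfl
/-- Junction (`rfl`): the cup product is the tree's `BettiUniverse.cup` on the realising scheme. -/
theorem universeOf_cup (X : Var) (i j : ℕ) :
    (universeOf hHD hI hU h₃).cup X i j = BettiUniverse.cup (Var.scheme hU h₃ X) i j := rfl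
/-- Junction (`rfl`): the trace `H^k → ℚ` is the tree's `BettiUniverse.tr` of the (smooth projective) realisation. -/
theorem universeOf_tr (X : Var) (k : ℕ) :
    (universeOf hHD hI hU h₃).tr X k = BettiUniverse.tr (Var.isSmoothProjective hU h₃ X) k := rfl
/-- Junction (`rfl`): the CM abelian variety of `(K, Φ)` is the code `.cm (cmCode K Φ)`. -/
@[simp] theorem universeOf_cmAV (K : CMField) (Φ : CMType K) :
    (universeOf hHD hI hU h₃).cmAV K Φ = .cm (cmCode K Φ) := rfl
/-- Junction (`rfl`): the `K`-action on `H¹(A_{(K,Φ)})` is `cmActOf` of the code, transported along `cmCodeEquiv K Φ`. -/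
theorem universeOf_cmAct (K : CMField) (Φ : CMType K) :
    (universeOf hHD hI hU h₃).cmAct K Φ = cmActOf hHD hI hU h₃ (cmCode K Φ) K (cmCodeEquiv K Φ) := rfl
/-- Junction (`rfl`): the Picard modular surface of `(L, ι₁, V, Γ)` is the code `.pms (pmsCode L ι₁ V Γ)`. -/
@[simp] theorem universeOf_pms (L : CMField) (ι₁ : L →+* ℂ) (V : HermSpace3 L ι₁) (Γ : Level V) :
    (universeOf hHD hI hU h₃).pms L ι₁ V Γ = .pms (pmsCode L ι₁ V Γ) := rfl

/-- **Dictionary junction (arrow A3, KERNEL)**: the COR-CM conclusion `U.HC_CM` of the model universe IS the tree's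
`Milne1999.CodesHC` (both say: for every code `v` flagged CM, every Hodge class of `H^{2p}` of the realised variety lies
in the ℚ-span of algebraic cycle classes), by `Iff.rfl`. -/
theorem universeOf_hc_cm_iff_codesHC :
    (universeOf hHD hI hU h₃).HC_CM ↔ Literature.AlgebraicGeometry.Milne1999.CodesHC hHD hU h₃ :=
  Iff.rfl

end Junction

/-- **The Picard–CM model universe** `U`, over exactly the cited records (ii-a) `BallQuotientUniformised` and
(iii) `CMAbelianVarietyRealised` of `PicardCMPrerequisites` (p177598); (ii) is assembled by the kernel packaging
`ballQuotientUniformisedDatum_of`.  VERBATIM the package's `HodgeCM.Model.picardCMUniverse`. -/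
def picardCMUniverse (hHD : exists_isReal_hodgeModel) (hI : hodgePQ_independent_of_hodgeModel)
    (h₁ : BallQuotientUniformised)  (h₃ : CMAbelianVarietyRealised) :
    Universe :=
  universeOf hHD hI (ballQuotientUniformisedDatum_of h₁) h₃

end Model

end Summit.HodgeConjecture.CorCM
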